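import Summits.AnomalousDissipation.AnomalousDissipation.Theorems.BaireTransferDenseLoudDesignerForcesStubTrajectoryPowerBudget
import Summits.AnomalousDissipation.AnomalousDissipation.Theorems.BaireTransferDenseLoudDesignerForcesStubClassicalPeriodicWitness
import Literature.Analysis.FluidPDE.EnergySpaceTorusProofs
import Literature.Analysis.FluidPDE.PeriodicBoundedMildTorus
import Literature.Analysis.FunctionSpaces.TorusClassicalNSUniqueness

/-!
# States of smooth solenoidal fields and the state curve of a classical solution (line `ergodic-budget-selection-closing`,
# crux `BaireTransfer.DenseLoudDesignerForces`, stmt-AnomalousDissipation-1143) — part A of the periodic-orbit entry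

Definitions + sorry-free lemmas (fourth lead c3-0, 2026-08-16) preparing Entry P of the line (a loud hyperbolic PERIODIC classical orbit
lies in the residual set of Stub 1′) and, more generally, the NS phase carried by a time-periodic classical solution:

* `stateOf v : Hsp` — the `H`-state (the `L²` class in the energy space) of a field `v : T³ → ℝ³`, honest when `v` is smooth, divergence
  free and mean zero (junk `0` otherwise), with `rep_stateOf` (`rep (stateOf v) = v` a.e.), `norm_stateOf_sq`, `enstrophyObs_stateOf`,
  `eq_of_stateOf_eq` (two honest fields with the same state are EQUAL — continuous representatives), `norm_stateOf_sub_sq`;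
* the STATE CURVE `t ↦ stateOf (u t)` of a classical solution with mean-zero slices: continuity in `H` (`continuous_stateOf_slice`, from the
  uniform continuity in time of jointly smooth fields, `IsSmoothSpaceTimeOn.eventually_norm_sub_lt`), and FORWARD DETERMINISM
  (`slice_eq_of_stateOf_eq`: equal states at times `t₁`, `t₂` give equal slices at `t₁ + s`, `t₂ + s` for all `s ≥ 0`, by time translation
  and the forward uniqueness `Torus.IsClassicalNSSolutionOn.velocity_unique_of_mem`).

References: Constantin–Foias 1988 Ch. 4 (the space `H`); Robinson–Rodrigo–Sadowski 2016 §6.3 (uniqueness of strong solutions).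
-/

set_option linter.dupNamespace false

noncomputable section

open scoped BigOperators Topology ENNReal InnerProductSpace
open Filter Set Function MeasureTheory

namespace Summit.AnomalousDissipation.AnomalousDissipation.Theorems.DenseLoudDesignerForces.Ergodic

open Literature.Analysis.FunctionSpaces Literature.Analysis.FunctionSpaces.Torus
open Literature.Analysis.FluidPDE Literature.Analysis.FluidPDE.Torus
open Summit.AnomalousDissipation.AnomalousDissipation.Theses.BaireTransfer
open Summit.AnomalousDissipation.AnomalousDissipation.Theorems.DenseLoudDesignerForces.Negative

/-! ## The state of a field -/

section State

open Classical in
/-- **The `H`-state of a field** `v : T³ → ℝ³`: the `L²` class of `v` as an element of the energy space `H` when `v` is smooth,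
divergence free and mean zero; junk `0` otherwise. [folklore] -/
def stateOf (v : (UnitAddTorus (Fin 3)) → (EuclideanSpace ℝ (Fin 3))) : Hsp :=
  if h : IsSmooth v ∧ IsDivFree v ∧ HasZeroMean v then
    ⟨(h.1.memLp 2).toLp v, smoothSolenoidal_subset_energySpace ⟨v, h.1, h.2.1, h.2.2, (h.1.memLp 2).coeFn_toLp⟩⟩
  else 0

variable {v w : (UnitAddTorus (Fin 3)) → (EuclideanSpace ℝ (Fin 3))}

/-- The state of an honest field is represented by the field: `rep (stateOf v) = v` a.e. [folklore] -/
theorem rep_stateOf (hs : IsSmooth v) (hdiv : IsDivFree v) (hmean : HasZeroMean v) : rep (stateOf v) =ᵐ[volume] v := by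
  have h : IsSmooth v ∧ IsDivFree v ∧ HasZeroMean v := ⟨hs, hdiv, hmean⟩
  unfold stateOf
  rw [dif_pos h]
  exact (h.1.memLp 2).coeFn_toLp

/-- `‖stateOf v‖² = ∫‖v‖²`. [folklore] -/
theorem norm_stateOf_sq (hs : IsSmooth v) (hdiv : IsDivFree v) (hmean : HasZeroMean v) :
    ‖stateOf v‖ ^ 2 = ∫ y, ‖v y‖ ^ 2 :=
  stub_trajectoryPowerBudget_aux_norm_sq _ (rep_stateOf hs hdiv hmean)

/-- `enstrophyObs (stateOf v) = ‖∇v‖₂²`. [folklore] -/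
theorem enstrophyObs_stateOf (hs : IsSmooth v) (hdiv : IsDivFree v) (hmean : HasZeroMean v) :
    enstrophyObs (stateOf v) = gradNormSq v :=
  stub_trajectoryPowerBudget_aux_enstrophyObs_eq _ hs (rep_stateOf hs hdiv hmean)

/-- Two smooth fields which are a.e. equal are equal (Haar measure on the torus charges open sets). [folklore] -/
theorem eq_of_ae_eq_of_isSmooth (hv : IsSmooth v) (hw : IsSmooth w) (h : v =ᵐ[volume] w) : v = w :=
  (Continuous.ae_eq_iff_eq volume hv.continuous hw.continuous).1 h

/-- Honest fields with the same state are equal. [folklore] -/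
theorem eq_of_stateOf_eq (hv : IsSmooth v) (hvd : IsDivFree v) (hvm : HasZeroMean v) (hw : IsSmooth w) (hwd : IsDivFree w)
    (hwm : HasZeroMean w) (h : stateOf v = stateOf w) : v = w :=
  eq_of_ae_eq_of_isSmooth hv hw ((rep_stateOf hv hvd hvm).symm.trans (h ▸ rep_stateOf hw hwd hwm))

/-- The distance of two states is the `L²` distance of the fields: `‖stateOf v − stateOf w‖² = ∫‖v − w‖²`. [folklore] -/
theorem norm_stateOf_sub_sq (hv : IsSmooth v) (hvd : IsDivFree v) (hvm : HasZeroMean v) (hw : IsSmooth w) (hwd : IsDivFree w)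
    (hwm : HasZeroMean w) : ‖stateOf v - stateOf w‖ ^ 2 = ∫ y, ‖v y - w y‖ ^ 2 := by
  have hrep : rep (stateOf v - stateOf w) =ᵐ[volume] fun y => v y - w y := by
    have h1 : rep (stateOf v - stateOf w) =ᵐ[volume] fun y => rep (stateOf v) y - rep (stateOf w) y := by
      show (((stateOf v - stateOf w : Hsp) : Lp (EuclideanSpace ℝ (Fin 3)) 2 (volume : Measure (UnitAddTorus (Fin 3)))) :
          (UnitAddTorus (Fin 3)) → (EuclideanSpace ℝ (Fin 3))) =ᵐ[volume] _
      rw [Submodule.coe_sub]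
      exact Lp.coeFn_sub _ _
    filter_upwards [h1, rep_stateOf hv hvd hvm, rep_stateOf hw hwd hwm] with y hy h2 h3
    rw [hy, h2, h3]
  exact stub_trajectoryPowerBudget_aux_norm_sq _ hrep

end State

/-! ## The state curve of a classical solution -/

section StateCurve

variable {ν : ℝ} {F : (UnitAddTorus (Fin 3)) → (EuclideanSpace ℝ (Fin 3))}
  {u : ℝ → (UnitAddTorus (Fin 3)) → (EuclideanSpace ℝ (Fin 3))} {p : ℝ → (UnitAddTorus (Fin 3)) → ℝ}

/-- Slices of a classical solution on `ℝ × T³` are smooth. [folklore] -/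
theorem isSmooth_slice_of_univ (hsol : IsClassicalNSSolutionOn univ ν (fun _ => F) u p) (t : ℝ) : IsSmooth (u t) :=
  hsol.smooth_velocity.isSmooth_slice (mem_univ t)

/-- **Continuity of the state curve**: for a classical solution with mean-zero slices, `t ↦ stateOf (u t)` is continuous into `H`
(uniform continuity in time of a jointly smooth field on the compact torus). [folklore] -/
theorem continuous_stateOf_slice (hsol : IsClassicalNSSolutionOn univ ν (fun _ => F) u p) (hmean : ∀ t, HasZeroMean (u t)) :
    Continuous fun t : ℝ => stateOf (u t) := by
  have hs := isSmooth_slice_of_univ hsol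
  have hd : ∀ t, IsDivFree (u t) := fun t => hsol.divFree t (mem_univ t)
  refine continuous_iff_continuousAt.2 fun t₀ => ?_
  rw [ContinuousAt, Metric.tendsto_nhds]
  intro ε hε
  obtain ⟨η, hη, hηε⟩ : ∃ η : ℝ, 0 < η ∧ η ^ 2 < ε ^ 2 := ⟨ε / 2, by positivity, by nlinarith⟩
  have hev : ∀ᶠ t in 𝓝 t₀, ∀ x, ‖u t x - u t₀ x‖ < η := by
    have h := hsol.smooth_velocity.eventually_norm_sub_lt (mem_univ t₀) hη
    rwa [nhdsWithin_univ] at h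
  filter_upwards [hev] with t ht
  rw [dist_eq_norm]
  have hsq : ‖stateOf (u t) - stateOf (u t₀)‖ ^ 2 < ε ^ 2 := by
    rw [norm_stateOf_sub_sq (hs t) (hd t) (hmean t) (hs t₀) (hd t₀) (hmean t₀)]
    calc ∫ y, ‖u t y - u t₀ y‖ ^ 2 ≤ ∫ _ : UnitAddTorus (Fin 3), η ^ 2 := by
          refine integral_mono_of_nonneg (Eventually.of_forall fun y => sq_nonneg _) (integrable_const _)
            (Eventually.of_forall fun y => ?_)
          exact pow_le_pow_left₀ (norm_nonneg _) (ht y).le 2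
      _ = η ^ 2 := by simp
      _ < ε ^ 2 := hηε
  exact (abs_lt_of_sq_lt_sq' hsq hε.le).2

/-- **Forward determinism read on states**: if the states of a classical solution (steady force, mean-zero slices) agree at times `t₁`
and `t₂`, then its slices agree at `t₁ + s` and `t₂ + s` for every `s ≥ 0` (time translation + forward uniqueness of classical
solutions). [folklore] -/
theorem slice_eq_of_stateOf_eq (hν : 0 ≤ ν) (hsol : IsClassicalNSSolutionOn univ ν (fun _ => F) u p)
    (hmean : ∀ t, HasZeroMean (u t)) {t₁ t₂ : ℝ} (h : stateOf (u t₁) = stateOf (u t₂)) {s : ℝ} (hs : 0 ≤ s) :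
    u (t₁ + s) = u (t₂ + s) := by
  have hsm := isSmooth_slice_of_univ hsol
  have hd : ∀ t, IsDivFree (u t) := fun t => hsol.divFree t (mem_univ t)
  have h0 : u t₁ = u t₂ := eq_of_stateOf_eq (hsm t₁) (hd t₁) (hmean t₁) (hsm t₂) (hd t₂) (hmean t₂) h
  -- the two time translates are classical solutions on `univ` agreeing at time `0`
  have h₁ := hsol.comp_add_const t₁
  have h₂ := hsol.comp_add_const t₂
  rw [preimage_univ] at h₁ h₂
  have key := IsClassicalNSSolutionOn.velocity_unique_of_mem hν convex_univ h₁ h₂ (mem_univ 0)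
    (by simpa only [zero_add] using h0) (mem_univ s) hs
  simpa only [add_comm s] using key

/-- The state curve inherits every period of the solution. [folklore] -/
theorem stateOf_slice_periodic {τ : ℝ} (hper : Periodic u τ) : Periodic (fun t : ℝ => stateOf (u t)) τ := fun t => by
  simp only [hper t]

end StateCurve

end Summit.AnomalousDissipation.AnomalousDissipation.Theorems.DenseLoudDesignerForces.Ergodic

end
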